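import Mathlib.RingTheory.DiscreteValuationRing.Basic
import Mathlib.RingTheory.Ideal.Height
import Mathlib.RingTheory.KrullDimension.Basic
import Mathlib.RingTheory.RegularLocalRing.Defs
import Literature.AlgebraicGeometry.Resolution.QuadraticTransforms
import HarnessLib

/-!
# Heinzer–Loper–Olberding–Schoutens–Toeniskoetter: a Shannon extension which is a valuation
# ring has rank at most two, and in rank two its rank-one coarsening is an essential prime
# divisor of some member of the sequence (arXiv:1505.06445, Thm. 8.1 with Thm. 4.1 / Rem. 4.3)

Topic: `Literature/AlgebraicGeometry/Resolution`. NAMED FACT (filed on a planner's WANTED line,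
D-0014 «NEED A PUBLISHED FACT»; cell `res-hironaka`, rung L, slot W4.1, crux `Steer`
`stmt-ResolutionOfSingularities-16345`, R1 side, piece S0 `CompositeRankSS`: res-L0-w41-plan-1
RULING ×6 2026-08-27T07:20:27Z, RULING 5 — «the ν₁ discharge = HOT [corpus: paper:arxiv-1505.06445
p0016 Thm 8.1, p0017 Lemma 8.6 / Prop 8.7] is UNHELD ⇒ WANTED (a Shannon extension that is a
valuation ring of dim > 1 has a DISCRETE rank-one coarsening)»; consumer = the «H1D-DISCRETE»
binder of res-type-028's `concl_of_discreteCoarsening_of_luZeroDimBelow`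
(`StronglySwitching O A₀ → HasProperCoarsening O → ∃ O₁, O ≤ O₁ ∧ O ≠ O₁ ∧ O₁ ≠ ⊤ ∧ Discrete O₁`),
to be bridged in a Theorems file).  Sibling of `AbhyankarQuadraticUnion` (`QuadraticTransforms.lean`:
the dimension-two case, where the union of the quadratic sequence along `O` IS `O`).

## What the source prints (arXiv:1505.06445, W. Heinzer, K. A. Loper, B. Olberding, H. Schoutens,
## M. Toeniskoetter, «Ideal theory of infinite directed unions of local quadratic transforms»,
## J. Algebra 474 (2017) 213–239; chunks read 2026-08-27 from the held copy `paper:arxiv-1505.06445`)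

* §1 (chunk p0003): «we refer to the directed union `S = ⋃_{i ≥ 0} R_i` of the local quadratic
  transforms of `R` along a valuation ring as the Shannon extension of `R` along this valuation
  ring.»
* **Setting 3.1** (chunk p0007), VERBATIM: «We make the following assumptions throughout the rest of
  the paper. (1) `(R, 𝔪)` is a regular local ring with quotient field `F` such that `dim R ≥ 2`.
  (2) `{(R_i, 𝔪_i)}` is an infinite sequence of local quadratic transforms of regular local rings
  starting from `R_0 = R`. That is, for each `i > 0`, `R_i` is a local quadratic transform of
  `R_{i-1}`, so `R_i` is a regular local ring, `R_{i-1} ⊊ R_i`, and, by Remark (dim remark),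
  `dim R_{i-1} ≥ dim R_i ≥ 2`. (3) `S = ⋃_{i=0}^∞ R_i` is the Shannon extension of `R` along `{R_i}`
  and `N = ⋃_{i=0}^∞ 𝔪_i` is the maximal ideal of `S`.»
* **Theorem 4.1** (chunk p0009), VERBATIM: «Assuming Setting 3.1, let `T` be the intersection of all
  the DVRs with quotient field `F` that properly contain `S`, where an empty intersection equals `F`.
  Then the following statements hold for `T`. (1) `T = S[1/x]` for any `x ∈ N` such that `xS` is
  `N`-primary. Furthermore, `T` is a localization of `R_i` for `i ≫ 0`. In particular, `T` is a UFD.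
  […] (3) The ring `T` is a Noetherian regular ring that is the unique minimal proper Noetherian
  overring of `S` in `F`.» (`T` = the Noetherian hull of `S`, Definition 4.2), and **Remark 4.3**
  (same chunk), VERBATIM: «Assume the notation of Setting 3.1 and assume `dim S > 1`. […] The proof
  of Theorem 4.1(1) shows that for every height 1 prime ideal `P` of `S` we have
  `S_P = (R_n)_{pR_n} = T_{pT}` for some prime element `p` of `R_n`.»
* **Theorem 8.1** (chunk p0016), VERBATIM: «The following are equivalent for a Shannon extension `S`
  of a regular local ring `R`. (1) `S` is a valuation ring. (2) `S` has only finitely many height 1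
  prime ideals. (3) Either (a) `dim S = 1` or (b) `dim S = 2` and the boundary valuation ring `V` of
  `S` has value group `ℤ ⊕ G`, where `G` is a subgroup of `ℚ` and the direct sum is ordered
  lexicographically.»; proof of (1) ⇒ (3), VERBATIM: «Suppose that `S` is a valuation ring. If `S` is
  a DVR, the claim is clear, so suppose that `S` is not a DVR. As an overring of the valuation ring
  `S`, `T` is a valuation ring, and hence the Noetherian ring `T` is either a DVR or the quotient
  field of `S`. If `dim S > 1`, then necessarily `T` is a DVR, and since every nonmaximal prime
  ideal of `S` survives in `T = S[1/x]`, this forces `dim S = 2`.»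
* **Remark 2.4** (chunk p0005): «`S` is a rank 1 valuation domain if and only if `epd(S/R) = ∅`
  [Sha] [footnote: In this case, the sequence `{R_i}` switches strongly infinitely often.] and `S` is
  a rank 2 valuation domain if and only if `epd(S/R)` consists of a single element [Gra]
  [footnote: In this case, the sequence `{R_i}` is height 1 directed.]», and **Lemma 8.6 /
  Proposition 8.7** (chunk p0017): for `dim S > 1`, `epd(S/R) = epd(S)` (every height-one
  localisation `S_P` is `(R_i)_{P ∩ R_i}` with `P ∩ R_i` a height 1 prime of `R_i`); `S` is a
  valuation ring iff `{R_i}` switches strongly infinitely often (`dim S = 1`) or is height 1 directed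
  (`dim S = 2`, value group `G ⊕ ℤ`).

## Print placement of the form below (why it is WEAKER than print)

Data inside one field `K` (the `F` of print): `O` a valuation ring of `K`; `R : ℕ → Subring K` with
`R 0` a regular local ring of Krull dimension `≥ 2` whose field of fractions is `K`
(`IsLocalRingOf`), dominated by `O`; every `R (i+1)` the quadratic transform of `R i` ALONG `O`
(`IsQuadraticTransformAlong`, Cutkosky §2.2 — the tree's notion; that it is a local quadratic
transform in the sense of print is `IsQuadraticTransformAlong.isQuadraticTransform`); all members of
dimension `≥ 2` (Setting 3.1 (2); then `R i ⊊ R (i+1)` is automatic: `𝔪_i` is not principal, so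
`y/x ∉ R i` for some `y ∈ 𝔪_i`, while `y/x ∈ R (i+1)` — hence the sequence is infinite and `⋃ R i`
is the Shannon extension of `R 0` along `O`, Setting 3.1 (3)).  Hypothesis «`S` is a valuation
ring» (Thm. 8.1 (1)) is rendered as «every element of `O` lies in some `R i`», i.e. `S = O` (the
members lie in `O` by `IsQuadraticTransformAlong.target_le`; conversely a valuation ring `S`
dominated by the valuation ring `O` of the same field equals `O`).  Conclusion: Thm. 8.1 (3) read
through its proof and Thm. 4.1 (1) / Rem. 4.3: either `dim O ≤ 1` ((a); we allow `≤` — weaker), or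
`dim O = 2` and the valuation ring strictly between `O` and `K` — the localisation `S_P` at the
height-one prime, = the Noetherian hull `T`, a DVR — is `(R_n)_{pR_n}` for a height-one prime
`pR_n` of some member (Rem. 4.3; a prime element of the UFD `R_n` generates a height-one prime).
The value-group clause «`ℤ ⊕ G`, `G ≤ ℚ`» of (3)(b) is NOT asserted (weaker than print); the
equivalence with (2) and the converse (3) ⇒ (1) are NOT asserted.  NOT in print and NOT claimed:
anything for sequences that are not along a valuation ring dominating them, or for `dim R = 1`.

-- TODO(general form): Theorem 8.1 in full ((1) ⇔ (2) ⇔ (3) with the value group `ℤ ⊕_lex G`,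
-- `G ≤ ℚ`, of the boundary valuation ring), Theorem 4.1 (the Noetherian hull `T = S[1/x]`) and
-- Theorem 5.4 (`S = V ∩ T`) for arbitrary Shannon extensions — needs the boundary valuation ring and
-- the Noetherian hull as tree objects.

References: W. Heinzer, K. A. Loper, B. Olberding, H. Schoutens, M. Toeniskoetter, *Ideal theory
of infinite directed unions of local quadratic transforms*, J. Algebra 474 (2017) 213–239
(= arXiv:1505.06445), Setting 3.1, Thm. 4.1, Rem. 4.3, Thm. 8.1, Rem. 2.4, Lemma 8.6, Prop. 8.7
[HeinzerEtAl2015]; S. D. Cutkosky (2014), §2.1–2.2 (local rings of `K`, domination, quadratic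
transforms along a valuation — the tree's `QuadraticTransforms.lean`) [Cutkosky2014].
-/

noncomputable section

namespace Literature.AlgebraicGeometry.Resolution

open IsLocalRing

universe u

/-- NAMED FACT — **Heinzer–Loper–Olberding–Schoutens–Toeniskoetter 2017, Theorem 8.1 (1) ⇒ (3)
(with Theorem 4.1 (1) / Remark 4.3), for the Shannon extension along a dominating valuation
ring: if the union of the infinite sequence of quadratic transforms of a regular local ring `R 0`
of dimension `≥ 2` along a valuation ring `O` of its fraction field is all of `O` (the Shannon
extension IS a valuation ring), then either `O` has Krull dimension `≤ 1`, or `O` has Krull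
dimension `2` and the valuation ring strictly between `O` and the field is a DISCRETE valuation
ring, namely the localisation of some member `R i` at a height-one prime** (Thm. 8.1, chunk p0016:
«(1) `S` is a valuation ring» ⇒ «(3) Either (a) `dim S = 1` or (b) `dim S = 2` and […]», proof:
«If `dim S > 1`, then necessarily `T` is a DVR, and since every nonmaximal prime ideal of `S`
survives in `T = S[1/x]`, this forces `dim S = 2`»; Thm. 4.1 (1), chunk p0009: «`T` is a
localization of `R_i` for `i ≫ 0`»; Rem. 4.3: «for every height 1 prime ideal `P` of `S` we have
`S_P = (R_n)_{pR_n} = T_{pT}` for some prime element `p` of `R_n`»).  Data, inside one field `K`: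
`O : ValuationSubring K`; `R : ℕ → Subring K` with `R 0` regular local, of fraction field `K`
(`IsLocalRingOf`), dominated by `O`, every member of Krull dimension `≥ 2` (Setting 3.1), each
`R (i+1)` the quadratic transform of `R i` ALONG `O` (`IsQuadraticTransformAlong`); hypothesis:
every element of `O` lies in some `R i`.  Conclusion: `ringKrullDim O ≤ 1`, or `ringKrullDim O = 2`
and there is a valuation subring `O₁` with `O < O₁`, `O₁ ≠ ⊤`, `O₁` a discrete valuation ring, and
`O₁ = (R i)_P` for some `i` and some prime `P` of `R i` of height one (membership form: `z ∈ O₁` iff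
`z = a / b` with `a b ∈ R i`, `b ∉ P`).  The reduction of this form to the printed statements is the
paragraph «Print placement» of the module docstring.  Weaker than print ((1) ⇒ (3) only; the value
group `ℤ ⊕_lex G` of (3)(b) is not asserted; sequences along a dominating valuation ring only).
Users take `(h : HeinzerEtAl2015ShannonValuationRankTwo)`.
[cite: HeinzerEtAl2015, Thm. 8.1 (1)⇒(3), Thm. 4.1 (1), Rem. 4.3, Setting 3.1]
[cite: Cutkosky2014, §2.2] -/
def HeinzerEtAl2015ShannonValuationRankTwo : Prop :=
  ∀ (K : Type u) [Field K] (O : ValuationSubring K) (R : ℕ → Subring K),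
    IsRegularLocalRing (R 0) → IsLocalRingOf (R 0) →
    (∀ i, (2 : WithBot ℕ∞) ≤ ringKrullDim (R i)) →
    SubringDominates (R 0) O.toSubring →
    (∀ i, IsQuadraticTransformAlong O (R i) (R (i + 1))) →
    (∀ z : K, z ∈ O → ∃ i, z ∈ R i) →
    ringKrullDim O ≤ 1 ∨
      (ringKrullDim O = 2 ∧
        ∃ O₁ : ValuationSubring K, O < O₁ ∧ O₁ ≠ ⊤ ∧ IsDiscreteValuationRing O₁ ∧
          ∃ (i : ℕ) (P : Ideal (R i)), P.IsPrime ∧ P.height = 1 ∧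
            ∀ z : K, z ∈ O₁ ↔ ∃ a b : R i, b ∉ P ∧ z = (a : K) / (b : K))

end Literature.AlgebraicGeometry.Resolution

end
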